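import Summits.QuantumFields.YangMills.Theorems.NPointIsotropy.Negative.ModelBlindFalse

/-!
# `CurvatureAmnesia` — negative side II: the Σ5 rotation and the geometric core `J (R · F₀) = 0`

Standing disprover of crux `stmt-QuantumFields-16192`, cycle 1, file 2/3.

* `Rσ`: the rotation `cos θ = 3/5` of the `(x₂,x₃)`-plane as a product of two mirrors, with the four defining
  equations of the crux's conclusion (`Rσ_isSigmaFive`).
* `no_fit_sigmaFive`, `J_RσF₀`: the degree-4 junk functional `J` of `NPointIsotropy.Negative` (the
  `W(B₄) × S₄`-symmetrised integral over the 7-plane `(x, x+se₃, x+te₂, x+re₀)`) kills the Σ5-rotated bump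
  tensor `F₀ ∈ ⁰𝒮` at `(0, 10e₃, 10e₂, 10e₀)`: a rotated offset has coordinates `2, 3` of size `≥ 6`, an axis
  vector at most one non-zero coordinate, and bumps have radius `1`. (`J F₀ ≠ 0` is `J_F₀_re_pos` there.)
-/

noncomputable section

-- Mathlib's `SimplexCategory` instance `Fintype (Fin (x.len + 1))` matches `Fintype (Fin 4)` and makes concrete
-- `Fin 4` instance paths diverge between elaborations (tree-known workaround, cf. `NPointIsotropy.Negative`).
attribute [-instance] SimplexCategory.instFintypeToTypeOrderHomFinHAddNatLenOfNat

namespace Summit.QuantumFields.YangMills.Theorems.CurvatureAmnesia.Negative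

open scoped BigOperators SchwartzMap ComplexConjugate InnerProductSpace
open MeasureTheory Filter Topology
open Literature.MathematicalPhysics.QuantumLattice Literature.MathematicalPhysics.AQFT
  Literature.MathematicalPhysics.QuantumFieldTheory
open Summit.QuantumFields.YangMills.Theorems.NPointIsotropy.Negative

/-! ## §3 The Σ5 rotation and the geometric core `J (R · F₀) = 0` -/

/-- `g₂ = (3e₂ + 4e₃)/5`, the image of `e₂`. -/
def g2 : E4 := (3 / 5 : ℝ) • e 2 + (4 / 5 : ℝ) • e 3

/-- `‖g₂‖ = 1`. -/
theorem norm_g2 : ‖g2‖ = 1 := by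
  have h : ‖g2‖ ^ 2 = 1 := by
    rw [EuclideanSpace.norm_sq_eq]
    simp [g2, e, Fin.sum_univ_four]
    norm_num
  nlinarith [norm_nonneg g2]

/-- First mirror: negate `e₃`. -/
def μ₁ : E4 ≃ₗᵢ[ℝ] E4 := (ℝ ∙ (e 3 - (-e 3)))ᗮ.reflection

/-- Second mirror: swap `e₂ ↔ g₂`. -/
def μ₂ : E4 ≃ₗᵢ[ℝ] E4 := (ℝ ∙ (e 2 - g2))ᗮ.reflection

/-- **The Σ5 rotation** `R`: `e₀ ↦ e₀`, `e₁ ↦ e₁`, `e₂ ↦ (3e₂+4e₃)/5`, `e₃ ↦ (−4e₂+3e₃)/5`. -/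
def Rσ : E4 ≃ₗᵢ[ℝ] E4 := μ₁.trans μ₂

/-- `μ₁ e₃ = −e₃` (the defining property of the first mirror). -/
theorem μ₁_e3 : μ₁ (e 3) = -e 3 := Submodule.reflection_sub (by rw [norm_neg])

/-- `μ₁` fixes `e₀`. -/
theorem μ₁_e0 : μ₁ (e 0) = e 0 :=
  reflection_fix (by rw [sub_neg_eq_add, inner_add_left, inner_e_e]; simp)

/-- `μ₁` fixes `e₁`. -/
theorem μ₁_e1 : μ₁ (e 1) = e 1 :=
  reflection_fix (by rw [sub_neg_eq_add, inner_add_left, inner_e_e]; simp)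

/-- `μ₁` fixes `e₂`. -/
theorem μ₁_e2 : μ₁ (e 2) = e 2 :=
  reflection_fix (by rw [sub_neg_eq_add, inner_add_left, inner_e_e]; simp)

/-- `μ₂ e₂ = g₂` (the defining property of the second mirror). -/
theorem μ₂_e2 : μ₂ (e 2) = g2 := Submodule.reflection_sub (by rw [norm_e, norm_g2])

/-- `μ₂ g₂ = e₂` (mirrors are involutions). -/
theorem μ₂_g2 : μ₂ g2 = e 2 := by
  have h := Submodule.reflection_reflection (ℝ ∙ (e 2 - g2))ᗮ (e 2)
  change μ₂ (μ₂ (e 2)) = e 2 at h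
  rwa [μ₂_e2] at h

/-- `μ₂` fixes `e₀`. -/
theorem μ₂_e0 : μ₂ (e 0) = e 0 :=
  reflection_fix (by simp [g2, inner_sub_left, inner_add_left, real_inner_smul_left, inner_e_e])

/-- `μ₂` fixes `e₁`. -/
theorem μ₂_e1 : μ₂ (e 1) = e 1 :=
  reflection_fix (by simp [g2, inner_sub_left, inner_add_left, real_inner_smul_left, inner_e_e])

/-- `e₃ = (5/4) g₂ − (3/4) e₂`. -/
theorem e3_eq : e 3 = (5 / 4 : ℝ) • g2 - (3 / 4 : ℝ) • e 2 := by
  simp only [g2, smul_add, smul_smul]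
  ext k
  fin_cases k <;> simp [e]

/-- `μ₂ e₃ = (4e₂ − 3e₃)/5`, by linearity from `μ₂ e₂`, `μ₂ g₂`. -/
theorem μ₂_e3 : μ₂ (e 3) = (4 / 5 : ℝ) • e 2 - (3 / 5 : ℝ) • e 3 := by
  conv_lhs => rw [e3_eq]
  rw [map_sub, LinearIsometryEquiv.map_smul, LinearIsometryEquiv.map_smul, μ₂_g2, μ₂_e2]
  simp only [g2, smul_add, smul_smul]
  ext k
  fin_cases k <;> simp [e] <;> norm_num

/-- `R e₀ = e₀`. -/
theorem Rσ_e0 : Rσ (EuclideanSpace.single 0 1) = EuclideanSpace.single 0 1 := by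
  change μ₂ (μ₁ (e 0)) = e 0
  rw [μ₁_e0, μ₂_e0]

/-- `R e₁ = e₁`. -/
theorem Rσ_e1 : Rσ (EuclideanSpace.single 1 1) = EuclideanSpace.single 1 1 := by
  change μ₂ (μ₁ (e 1)) = e 1
  rw [μ₁_e1, μ₂_e1]

/-- `R e₂ = (3e₂ + 4e₃)/5`. -/
theorem Rσ_e2 : Rσ (EuclideanSpace.single 2 1) =
    (3/5 : ℝ) • EuclideanSpace.single 2 1 + (4/5 : ℝ) • EuclideanSpace.single 3 1 := by
  change μ₂ (μ₁ (e 2)) = (3/5 : ℝ) • e 2 + (4/5 : ℝ) • e 3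
  rw [μ₁_e2, μ₂_e2]
  rfl

/-- `R e₃ = (−4e₂ + 3e₃)/5`. -/
theorem Rσ_e3 : Rσ (EuclideanSpace.single 3 1) =
    -((4/5 : ℝ) • EuclideanSpace.single 2 1) + (3/5 : ℝ) • EuclideanSpace.single 3 1 := by
  change μ₂ (μ₁ (e 3)) = -((4/5 : ℝ) • e 2) + (3/5 : ℝ) • e 3
  rw [μ₁_e3, map_neg, μ₂_e3]
  ext k
  fin_cases k <;> simp [e]

/-- `R` satisfies the four defining equations of the crux's conclusion. -/
theorem Rσ_isSigmaFive :
    Rσ (EuclideanSpace.single 0 1) = EuclideanSpace.single 0 1 ∧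
      Rσ (EuclideanSpace.single 1 1) = EuclideanSpace.single 1 1 ∧
      Rσ (EuclideanSpace.single 2 1) = (3/5 : ℝ) • EuclideanSpace.single 2 1 + (4/5 : ℝ) • EuclideanSpace.single 3 1 ∧
      Rσ (EuclideanSpace.single 3 1) = -((4/5 : ℝ) • EuclideanSpace.single 2 1) + (3/5 : ℝ) • EuclideanSpace.single 3 1 :=
  ⟨Rσ_e0, Rσ_e1, Rσ_e2, Rσ_e3⟩

/-! ### The geometric core: `J (R · F₀) = 0` -/

/-- The rotated centres `R (ctr i)`: `0`, `−8e₂+6e₃`, `6e₂+8e₃`, `10e₀`. -/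
def rctr : Fin 4 → E4 :=
  ![0, (-8 : ℝ) • e 2 + (6 : ℝ) • e 3, (6 : ℝ) • e 2 + (8 : ℝ) • e 3, (10 : ℝ) • e 0]

/-- `R` maps the centres of the bump tensor to `rctr`. -/
theorem Rσ_ctr (i : Fin 4) : Rσ (ctr i) = rctr i := by
  have h0 : Rσ (e 0) = e 0 := Rσ_e0
  have h2 : Rσ (e 2) = (3/5 : ℝ) • e 2 + (4/5 : ℝ) • e 3 := Rσ_e2
  have h3 : Rσ (e 3) = -((4/5 : ℝ) • e 2) + (3/5 : ℝ) • e 3 := Rσ_e3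
  fin_cases i
  · simp [ctr, rctr]
  · simp only [ctr, rctr, Fin.mk_one, Matrix.cons_val_one, Matrix.cons_val_zero, LinearIsometryEquiv.map_smul, h3]
    ext k; fin_cases k <;> simp [e] <;> norm_num
  · simp only [ctr, rctr, Fin.reduceFinMk, Matrix.cons_val, LinearIsometryEquiv.map_smul, h2]
    ext k; fin_cases k <;> simp [e] <;> norm_num
  · simp only [ctr, rctr, Fin.reduceFinMk, Matrix.cons_val, LinearIsometryEquiv.map_smul, h0]

/-- The partner index: `0 ↦ 1`, `1 ↦ 0`, `2 ↦ 0`, `3 ↦ 1`. -/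
def partner (i : Fin 4) : Fin 4 := ![1, 0, 0, 1] i

/-- The partner index is a different index. -/
theorem partner_ne (i : Fin 4) : partner i ≠ i := by fin_cases i <;> decide

/-- Coordinates `2` and `3` of `R (ctr (partner i)) − R (ctr i)` are at least `6` in size. -/
theorem rctr_sub (i : Fin 4) :
    6 ≤ |(rctr (partner i)) 2 - (rctr i) 2| ∧ 6 ≤ |(rctr (partner i)) 3 - (rctr i) 3| := by
  fin_cases i <;> simp [rctr, partner, e] <;> norm_num

/-- **Geometric core**: no signed permutation of the pattern `A y ∘ π` equals `R z` with `z` bump-wise within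
distance `1` of the centres — the rotated offsets have two large coordinates, axis vectors only one. -/
theorem no_fit_sigmaFive (σ : Equiv.Perm (Fin 4)) (ε : Fin 4 → Bool) (π : Equiv.Perm (Fin 4)) (y : D7)
    (z : Fin 4 → E4) (hz : ∀ i, sp σ ε (A y (π i)) = Rσ (z i))
    (hball : ∀ i, z i ∈ Metric.ball (ctr i) 1) : False := by
  set i₀ : Fin 4 := π.symm 0 with hi₀
  have hπi₀ : π i₀ = 0 := by simp [hi₀]
  set j₀ : Fin 4 := partner i₀ with hj₀def
  have hj₀ : j₀ ≠ i₀ := partner_ne i₀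
  have hk0 : π j₀ ≠ 0 := fun h => hj₀ (π.injective (h.trans hπi₀.symm))
  obtain ⟨c, m, hcm⟩ := A_sub_axis y hk0
  -- the rotated difference is an axis vector
  have hw : Rσ (z j₀ - z i₀) = (c * sgn (ε m)) • EuclideanSpace.single (σ m) 1 := by
    rw [map_sub, ← hz j₀, ← hz i₀, hπi₀, ← map_sub, hcm, LinearIsometryEquiv.map_smul, sp_single,
      mul_one]
    ext k; by_cases hk : k = σ m <;> simp [hk, mul_comm]
  -- it is within 2 of d = R (ctr j₀ - ctr i₀)
  have hd : ‖Rσ (z j₀ - z i₀) - Rσ (ctr j₀ - ctr i₀)‖ < 2 := by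
    rw [← map_sub, LinearIsometryEquiv.norm_map]
    have h1 : ‖z j₀ - ctr j₀‖ < 1 := by simpa [dist_eq_norm] using hball j₀
    have h2 : ‖z i₀ - ctr i₀‖ < 1 := by simpa [dist_eq_norm] using hball i₀
    calc ‖z j₀ - z i₀ - (ctr j₀ - ctr i₀)‖ = ‖(z j₀ - ctr j₀) - (z i₀ - ctr i₀)‖ := by
          congr 1; abel
      _ ≤ ‖z j₀ - ctr j₀‖ + ‖z i₀ - ctr i₀‖ := norm_sub_le _ _
      _ < 2 := by linarith
  obtain ⟨hd2, hd3⟩ := rctr_sub i₀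
  rw [← hj₀def, ← Rσ_ctr, ← Rσ_ctr] at hd2 hd3
  have hcoord : ∀ ℓ : Fin 4, |(Rσ (z j₀ - z i₀)) ℓ - ((Rσ (ctr j₀)) ℓ - (Rσ (ctr i₀)) ℓ)| < 2 := by
    intro ℓ
    have h1 := PiLp.norm_apply_le (Rσ (z j₀ - z i₀) - Rσ (ctr j₀ - ctr i₀)) ℓ
    rw [Real.norm_eq_abs, PiLp.sub_apply] at h1
    have h2 := h1.trans_lt hd
    rwa [map_sub Rσ (ctr j₀) (ctr i₀), PiLp.sub_apply] at h2
  rw [hw] at hcoord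
  by_cases hm : σ m = 2
  · have h1 := hcoord 3
    have hne : (3 : Fin 4) ≠ σ m := by rw [hm]; decide
    simp only [PiLp.smul_apply, PiLp.single_apply, if_neg hne, smul_eq_mul, mul_zero, zero_sub,
      abs_neg] at h1
    linarith
  · have h0 := hcoord 2
    have hne : (2 : Fin 4) ≠ σ m := fun h' => hm h'.symm
    simp only [PiLp.smul_apply, PiLp.single_apply, if_neg hne, smul_eq_mul, mul_zero, zero_sub,
      abs_neg] at h0
    linarith

/-- `J (R · F₀) = 0`: every integrand vanishes identically by `no_fit_sigmaFive`. -/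
theorem J_RσF₀ : J (linActMulti Rσ F₀) = 0 := by
  rw [J_apply]
  refine Finset.sum_eq_zero fun g _ => Finset.sum_eq_zero fun π _ => ?_
  have hz : (fun y : D7 => (linActMulti Rσ F₀) (fun i => sp g.1 g.2 (A y (π i)))) = fun _ => 0 := by
    funext y
    rw [linActMulti_apply, F₀_apply]
    by_contra hne
    have hne' : f₀ (fun i => Rσ.symm (sp g.1 g.2 (A y (π i)))) ≠ 0 := by
      simpa using hne
    exact no_fit_sigmaFive g.1 g.2 π y _ (fun i => by simp) (f₀_ball hne')
  rw [hz]
  simp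

end Summit.QuantumFields.YangMills.Theorems.CurvatureAmnesia.Negative

end
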